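import Mathlib
import Literature.MathematicalPhysics.QuantumFieldTheory.StrongCouplingActivities
import HarnessLib

/-!
# The Faddeev–Popov factor of the complete tree (axial) gauge is field-independent

Bałaban, *Ultraviolet stability of three-dimensional lattice pure gauge field theories*,
Comm. Math. Phys. **102** (1985) 255–275, p. 258: "The underintegral expression in `Tρ₀` is
invariant with respect to gauge transformations `u` fixed to `1` at points of the new lattice
`T⁽¹⁾`, i.e. `u(y) = 1` for `y ∈ T⁽¹⁾`. We remove this freedom in the domain `Ω₁` by a simple
Faddeev–Popov procedure, using the identity

  `∏_{y ∈ Ω₁⁽¹⁾} ∫ ∏_{x ∈ B(y), x ≠ y} du(x) δ_{Ax(y)}(U^u) = 1,   δ_{Ax(y)}(U) = ∏_{x ∈ B(y), x ≠ y} δ(U(Γ_{y,x}))`  (9)".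

Here `Γ_{y,x}` is the tree contour from the block centre `y` to `x`, and
`U^u(Γ_{y,x}) = u(y) U(Γ_{y,x}) u(x)⁻¹ = U(Γ_{y,x}) u(x)⁻¹` because `u(y) = 1`. The content of (9) —
and the reason no field-dependent Faddeev–Popov determinant (no ghost) appears in the axial-gauge
renormalization group step (10) of the same page — is that the gauge action on the gauge-fixing
variables is, for every fixed field `U`, a map that PRESERVES the product Haar measure `∏ du(x)`:

* in Bałaban's contour variables it is the coordinatewise map `u(x) ↦ U(Γ_{y,x}) · u(x)⁻¹`
  (a left translation after the inversion), `measurePreserving_mul_inv_pi`, whence the integral of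
  ANY function of `(U^u(Γ_{y,x}))_x` against `∏ du(x)` is independent of `U`
  (`lintegral_comp_mul_inv_pi_eq`) — with Bałaban's `∏ δ` this is (9);
* in the tree-BOND variables used by perturbative engines (complete rooted spanning tree `𝒯` of the
  block with parent map `p`, gauge condition `U(p(x), x) = 1` for every tree bond) it is the
  triangular map `Φ_U(u)_x = u(p(x)) · U(p(x),x) · u(x)⁻¹`, `u(root) = 1`
  (`treeGaugeMap`), which preserves `∏ du(x)` as well (`treeGaugeMap_measurePreserving`: peel the
  leaves; for a leaf `x` and fixed `u(p(x))` the fibre map is again inversion followed by a left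
  translation — Mathlib `MeasurePreserving.skew_product`), so that again
  `∫ F(Φ_U(u)) ∏ du(x) = ∫ F(w) ∏ dw(x)` for every measurable `F ≥ 0` and every `U`
  (`lintegral_comp_treeGaugeMap_eq`). This is the form of the argument written out in
  Dimock, arXiv:1410.2798, §2.1–2.2 ("gauge fixing on a tree … has a constant Jacobian";
  "This is a Fadeev-Popov argument") and it is what makes the two gauge conditions
  (contours `= 1` versus tree bonds `= 1`) interchangeable under the integral.

Consequently the Faddeev–Popov factor `Δ_FP(U) := [∫ ∏ du(x) ∏ δ(Φ_U(u)_x)]⁻¹` of the complete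
tree axial gauge is a field-independent constant and contributes nothing to any jet of the
effective action — in particular the `faddeev_popov_ghost` addend of the one-loop coefficient in
this gauge is `0` exactly.

The statements are proved for an arbitrary measurable group `G` and an arbitrary σ-finite measure
`μ` that is left-invariant and inversion-invariant (`Measure.IsMulLeftInvariant`,
`Measure.IsInvInvariant`); the normalised Haar measure of a compact group
(`Literature.MathematicalPhysics.QuantumFieldTheory.haarProbability`, instances
`haarProbability.instIsHaarMeasure` / `haarProbability.instIsInvInvariant` of
`StrongCouplingActivities`) is the case of the paper (`treeGaugeMap_measurePreserving_haar`).
The rooted tree is presented by a parent function on the labels `1, …, n` of the non-root vertices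
(label `0` = the root) with `parent(i) < i` — every finite rooted tree admits such a labelling
(by depth), in particular Bałaban's comb trees.

Everything in this file is proved; no named fact is introduced.
-/

namespace Literature.MathematicalPhysics.QuantumFieldTheory.Balaban1983to89.Beta.TreeGaugeFP

open _root_.MeasureTheory
open scoped ENNReal

section Algebra

variable {G : Type*} [Group G] {n : ℕ}

/-- The gauge transformation at ALL vertices `0, 1, …, n` of the rooted tree obtained from its
values `u` at the non-root vertices (`u j` sits at vertex `j.succ`) by `ū(root) = 1`
(p. 258: "`u(y) = 1` for `y ∈ T⁽¹⁾`"). [folklore] -/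
def rootExt (u : Fin n → G) : Fin (n + 1) → G :=
  Fin.cases 1 u

/-- `ū(root) = 1` (definitional unfolding). [folklore] -/
@[simp] private theorem rootExt_zero (u : Fin n → G) : rootExt u 0 = 1 := by
  simp [rootExt]

/-- `ū(j+1) = u j` (definitional unfolding). [folklore] -/
@[simp] private theorem rootExt_succ (u : Fin n → G) (j : Fin n) : rootExt u j.succ = u j := by
  simp [rootExt]

/-- The tree (axial) gauge map of a rooted tree presented by the parent function `parent`
(vertex `i.succ` hangs at vertex `parent i`) with tree-bond field `U i = U(parent i, i.succ)`:
`Φ_U(u)_i = ū(parent i) · U i · (u i)⁻¹`, the gauge transform of the tree-bond variables by a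
gauge transformation `u` with `u(root) = 1`. The complete axial gauge condition of the engines is
`Φ_U(u) = 1`. [folklore] -/
def treeGaugeMap (parent : Fin n → Fin (n + 1)) (U : Fin n → G) (u : Fin n → G) : Fin n → G :=
  fun i => rootExt u (parent i) * U i * (u i)⁻¹

/-- Definitional unfolding of `treeGaugeMap`. [folklore] -/
private theorem treeGaugeMap_apply (parent : Fin n → Fin (n + 1)) (U : Fin n → G)
    (u : Fin n → G) (i : Fin n) :
    treeGaugeMap parent U u i = rootExt u (parent i) * U i * (u i)⁻¹ := rfl

/-- `ū` at a vertex of label `< n + 1` only sees the first `n` values of `u`. [folklore] -/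
private theorem rootExt_castLT (u : Fin (n + 1) → G) (k : Fin (n + 2)) (hk : (k : ℕ) < n + 1) :
    rootExt u k = rootExt (fun j : Fin n => u j.castSucc) (k.castLT hk) := by
  rcases Fin.eq_zero_or_eq_succ k with rfl | ⟨m, rfl⟩
  · have h0 : ((0 : Fin (n + 2)).castLT hk) = 0 := Fin.ext (by simp)
    rw [h0, rootExt_zero, rootExt_zero]
  · have hm : (m : ℕ) < n := by
      simp only [Fin.val_succ] at hk
      omega
    have hs : (m.succ.castLT hk) = (m.castLT hm).succ := Fin.ext (by simp)
    rw [hs, rootExt_succ, rootExt_succ, Fin.castSucc_castLT]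

end Algebra

section General

variable {G : Type*} [Group G] [MeasurableSpace G] [MeasurableMul₂ G] [MeasurableInv G]
  (μ : Measure G) [SigmaFinite μ] [μ.IsMulLeftInvariant] [μ.IsInvInvariant]

/-! ### Bałaban's contour form: the coordinatewise map `u(x) ↦ c(x) u(x)⁻¹` -/

/-- For fixed group elements `c x` (in (9): the contour holonomies `U(Γ_{y,x})`), the map
`u ↦ (x ↦ c x · (u x)⁻¹)` — the gauge action `U^u(Γ_{y,x}) = U(Γ_{y,x}) u(x)⁻¹` for `u(y) = 1` —
preserves the product measure `∏ₓ dμ` of a left- and inversion-invariant `μ` (coordinatewise: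
inversion, then left translation by `c x`).
[cite: Balaban1985UV3, p.258 eq. (9)] -/
theorem measurePreserving_mul_inv_pi {ι : Type*} [Fintype ι] (c : ι → G) :
    MeasurePreserving (fun (u : ι → G) (x : ι) => c x * (u x)⁻¹)
      (Measure.pi fun _ : ι => μ) (Measure.pi fun _ : ι => μ) := by
  have h : ∀ x : ι, MeasurePreserving (fun g : G => c x * g⁻¹) μ μ := fun x => by
    simpa [div_eq_mul_inv] using Measure.measurePreserving_div_left μ (c x)
  exact measurePreserving_pi (fun _ : ι => μ) (fun _ : ι => μ) h

/-- Bałaban's identity (9), p. 258, in integrated form: for every measurable `F ≥ 0` and every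
choice of the contour holonomies `c x = U(Γ_{y,x})`,
`∫ F((c x · u(x)⁻¹)ₓ) ∏ du(x) = ∫ F(w) ∏ dw(x)` — the left-hand side does not depend on the
field `U`; with `F = ∏ₓ δ` (formally) this is `∫ ∏ du(x) δ_{Ax(y)}(U^u) = 1`.
[cite: Balaban1985UV3, p.258 eq. (9)] -/
theorem lintegral_comp_mul_inv_pi_eq {ι : Type*} [Fintype ι] (c : ι → G)
    (F : (ι → G) → ℝ≥0∞) (hF : Measurable F) :
    ∫⁻ u, F (fun x => c x * (u x)⁻¹) ∂(Measure.pi fun _ : ι => μ) =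
      ∫⁻ w, F w ∂(Measure.pi fun _ : ι => μ) :=
  (measurePreserving_mul_inv_pi μ c).lintegral_comp hF

/-! ### The tree-bond form: the triangular map `Φ_U(u)_x = u(p(x)) U(p(x),x) u(x)⁻¹` -/

variable {n : ℕ}

omit [MeasurableMul₂ G] [MeasurableInv G] in
/-- Measurability of `u ↦ ū(k)` (a constant or a coordinate projection). [folklore] -/
private theorem measurable_rootExt (k : Fin (n + 1)) :
    Measurable fun u : Fin n → G => rootExt u k := by
  rcases Fin.eq_zero_or_eq_succ k with rfl | ⟨m, rfl⟩
  · simp only [rootExt_zero]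
    exact measurable_const
  · simp only [rootExt_succ]
    exact measurable_pi_apply m

/-- **The tree gauge map preserves the product Haar measure** (field-independence of the
Faddeev–Popov factor of the complete tree axial gauge). For every rooted tree — parent function
with `parent i ≤ i`, i.e. the parent of vertex `i + 1` is one of `0, …, i` — every tree-bond field
`U` and every σ-finite left- and inversion-invariant measure `μ` on the measurable group `G`, the
map `u ↦ (ū(parent i) · U i · (u i)⁻¹)ᵢ` preserves `∏ᵢ dμ`. Proof by peeling the last vertex
(a leaf): conditionally on the other coordinates its coordinate undergoes an inversion followed by
a left translation (`MeasurePreserving.skew_product`, `measurePreserving_piFinSuccAbove`). This is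
the Haar-invariance argument behind Bałaban's (9)–(10), p. 258 (no `u`-dependent determinant in
(10)), in the tree-bond variables (Dimock, arXiv:1410.2798, §2.1–2.2).
[cite: Balaban1985UV3, p.258 eq. (9)–(10)] -/
theorem treeGaugeMap_measurePreserving :
    ∀ (n : ℕ) (parent : Fin n → Fin (n + 1)) (_ : ∀ i, (parent i : ℕ) ≤ i) (U : Fin n → G),
      MeasurePreserving (treeGaugeMap parent U) (Measure.pi fun _ : Fin n => μ)
        (Measure.pi fun _ : Fin n => μ) := by
  intro n
  induction n with
  | zero =>
    intro parent _ U
    have h : treeGaugeMap parent U = id := by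
      funext u i
      exact i.elim0
    rw [h]
    exact MeasurePreserving.id _
  | succ n IH =>
    intro parent hp U
    -- the tree with the last vertex (a leaf) removed
    have hlt : ∀ i : Fin (n + 1), ((parent i : ℕ)) < n + 1 := fun i =>
      lt_of_le_of_lt (hp i) i.isLt
    let parent' : Fin n → Fin (n + 1) := fun j => (parent j.castSucc).castLT (by
      have h := hp j.castSucc
      simp only [Fin.val_castSucc] at h
      omega)
    have hp' : ∀ j, (parent' j : ℕ) ≤ j := fun j => by
      have h := hp j.castSucc
      simpa [parent'] using h
    let U' : Fin n → G := fun j => U j.castSucc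
    have IH' := IH parent' hp' U'
    -- the coefficient of the last coordinate: `ū(parent(last)) · U(last)`, a function of the rest
    let plast : Fin (n + 1) := (parent (Fin.last n)).castLT (hlt _)
    let c : (Fin n → G) → G := fun u' => rootExt u' plast * U (Fin.last n)
    have hc : Measurable c :=
      (measurable_rootExt plast).mul_const _
    -- pointwise identification of the map on the last / the other coordinates
    have hlast : ∀ u : Fin (n + 1) → G, treeGaugeMap parent U u (Fin.last n) =
        c (fun j => u j.castSucc) * (u (Fin.last n))⁻¹ := fun u => by
      simp only [treeGaugeMap_apply, c]
      rw [rootExt_castLT u (parent (Fin.last n)) (hlt _)]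
    have hcast : ∀ (u : Fin (n + 1) → G) (j : Fin n), treeGaugeMap parent U u j.castSucc =
        treeGaugeMap parent' U' (fun j => u j.castSucc) j := fun u j => by
      simp only [treeGaugeMap_apply, U', parent']
      rw [rootExt_castLT u (parent j.castSucc) (hlt _)]
    -- the skew product on `(rest, last)` and its conjugate on `(last, rest)`
    have hfib : ∀ u' : Fin n → G, MeasurePreserving (fun g : G => c u' * g⁻¹) μ μ := fun u' => by
      simpa [div_eq_mul_inv] using Measure.measurePreserving_div_left μ (c u')
    have hsk : MeasurePreserving
        (fun q : (Fin n → G) × G => (treeGaugeMap parent' U' q.1, c q.1 * q.2⁻¹))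
        ((Measure.pi fun _ : Fin n => μ).prod μ) ((Measure.pi fun _ : Fin n => μ).prod μ) :=
      IH'.skew_product (g := fun (u' : Fin n → G) (g : G) => c u' * g⁻¹)
        ((hc.comp measurable_fst).mul measurable_snd.inv)
        (Filter.Eventually.of_forall fun u' => (hfib u').map_eq)
    have hΨ : MeasurePreserving
        (fun p : G × (Fin n → G) => (c p.2 * p.1⁻¹, treeGaugeMap parent' U' p.2))
        (μ.prod (Measure.pi fun _ : Fin n => μ)) (μ.prod (Measure.pi fun _ : Fin n => μ)) :=
      (Measure.measurePreserving_swap.comp hsk).comp Measure.measurePreserving_swap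
    -- conjugate by the measurable equivalence splitting off the last coordinate
    let e := MeasurableEquiv.piFinSuccAbove (fun _ : Fin (n + 1) => G) (Fin.last n)
    have he : MeasurePreserving e (Measure.pi fun _ : Fin (n + 1) => μ)
        (μ.prod (Measure.pi fun _ : Fin n => μ)) :=
      measurePreserving_piFinSuccAbove (fun _ : Fin (n + 1) => μ) (Fin.last n)
    have hconj : ∀ u : Fin (n + 1) → G, e (treeGaugeMap parent U u) =
        (c (e u).2 * ((e u).1)⁻¹, treeGaugeMap parent' U' (e u).2) := fun u => by
      have hinit : Fin.init u = fun j => u j.castSucc := rfl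
      refine Prod.ext ?_ ?_
      · simp [e, hlast, hinit]
      · funext j
        simp [e, hinit]
        exact hcast u j
    have hT : treeGaugeMap parent U =
        e.symm ∘ (fun p : G × (Fin n → G) => (c p.2 * p.1⁻¹, treeGaugeMap parent' U' p.2)) ∘ e := by
      funext u
      simp only [Function.comp_apply]
      rw [← hconj u, MeasurableEquiv.symm_apply_apply]
    rw [hT]
    exact he.symm.comp (hΨ.comp he)

/-- Integrated form in the tree-bond variables: for every measurable `F ≥ 0`, every rooted tree
and every tree-bond field `U`, `∫ F(Φ_U(u)) ∏ du = ∫ F(w) ∏ dw` — independent of `U`; with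
`F = ∏ δ` (formally) this says that the Faddeev–Popov factor of the complete tree axial gauge is a
field-independent constant (no ghost), the tree-bond reading of Bałaban's (9)–(10), p. 258.
[cite: Balaban1985UV3, p.258 eq. (9)–(10)] -/
theorem lintegral_comp_treeGaugeMap_eq (parent : Fin n → Fin (n + 1))
    (hp : ∀ i, (parent i : ℕ) ≤ i) (U : Fin n → G) (F : (Fin n → G) → ℝ≥0∞)
    (hF : Measurable F) :
    ∫⁻ u, F (treeGaugeMap parent U u) ∂(Measure.pi fun _ : Fin n => μ) =
      ∫⁻ w, F w ∂(Measure.pi fun _ : Fin n => μ) :=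
  (treeGaugeMap_measurePreserving μ n parent hp U).lintegral_comp hF

end General

/-! ### The case of the paper: the normalised Haar measure of a compact group -/

section Compact

variable {G : Type*} [Group G] [TopologicalSpace G] [IsTopologicalGroup G] [CompactSpace G]
  [MeasurableSpace G] [BorelSpace G] [SecondCountableTopology G]

/-- Bałaban's setting (compact gauge group, normalised Haar measure `du`): the tree gauge map of
any rooted tree and any field `U` preserves `∏ₓ du(x)`; hence the Faddeev–Popov factor of the
complete tree axial gauge used in (9)–(10), p. 258, is field-independent and the gauge fixing
produces no ghost term at any order. (Instances: `haarProbability.instIsHaarMeasure`,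
`haarProbability.instIsInvInvariant`.) [cite: Balaban1985UV3, p.258 eq. (9)–(10)] -/
theorem treeGaugeMap_measurePreserving_haar {n : ℕ} (parent : Fin n → Fin (n + 1))
    (hp : ∀ i, (parent i : ℕ) ≤ i) (U : Fin n → G) :
    MeasurePreserving (treeGaugeMap parent U)
      (Measure.pi fun _ : Fin n => haarProbability G) (Measure.pi fun _ : Fin n => haarProbability G) := by
  haveI : IsFiniteMeasure (haarProbability G) := by
    unfold haarProbability
    infer_instance
  exact treeGaugeMap_measurePreserving (haarProbability G) n parent hp U

end Compact

end Literature.MathematicalPhysics.QuantumFieldTheory.Balaban1983to89.Beta.TreeGaugeFP
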